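import Summits.HodgeConjecture.HodgeConjecture.Theorems.K2E3CongruenceLayerCharactersGL   -- ★ p855532 (this seat): `χ_X(k) = ψ(tr(X(k−1)))`, `map_trace_mul_coe_conj_sub_one`, `valuation_le_one_of_forall_map_mul_eq_one`, `isIntegralMatrix_single`, `trace_mul_smul_single`
import Literature.NumberTheory.Automorphic.CartanDecompositionGLnUnique                   -- ★ `exists_glInt_mul_zpowDiagGL_mul_eq_of_perm` (permuting Cartan exponents); brings ★ `CartanDecompositionGLnPowers.exists_glInt_mul_mul_eq_zpowDiagGL` (`G = K ϖ^a K`)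
import Literature.LinearAlgebra.Matrix.CommutatorNilpotent                               -- ★ `isNilpotent_of_blockTriangular_of_diag_eq_zero` (strictly triangular ⇒ nilpotent)
import HarnessLib

/-!
# Crux `H413` — K2-LIT E3 «EllipticInputs», U12-h engine (N): OCCURRENCE ⇒ NILPOTENT + BOUNDED — if the layer character `χ_X` of `K_{N'}` is trivial on `K_{N'} ∩ xK_{ν'}x⁻¹`
# (`x ∈ GL_n(F)` ARBITRARY), then `X = Z + B` with `Z` NILPOTENT and `v(B) ≤ |ϖ|^{−N'}` (the elementary form of HC1999 §20 (1) «`𝒪_0^G ⊂ 𝒩 + L_{ν₀}^*`», via the CARTAN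
# decomposition and per-entry non-degeneracy — no lattice duality, no compactness of `G⧸P`)

Cell `hodgecm-mathlib`, Track B «K2-LIT», crux item `stmt-HodgeConjecture-24833` (h413), line `K2_E3_EllipticInputs`, unit U12 «HC characters», socket U12-h
`sig_K2E3CharLocConstNearRegular` (‹#9L›): brick (N) of the «DEPTH HALVING» road (memo `K2/K2E1b-p08/g2/MEMO-H2-depth-halving.v1.K2E1b-p08-g2.md` (C3); seat K2E1b-p08 (g2) for the
9L line lead K2E3-p09 (g2) under K2E3-plan (g1)) — the OCC clause of ★ p855602's residual socket HF («`d` contains a vector fixed by `K₁ ∩ xK₀′x⁻¹`») read on the parameter of an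
abelian-layer constituent; `--supports stmt-HodgeConjecture-24833 --as helper`.  THEOREMS ONLY — no `def`, no named fact, no instance, no notation, no `sorry`.  GENERIC: any field with a
`ValuativeRel` whose valuation ring is a DVR (`[IsDiscreteValuationRing 𝒪[F]]`, for ★ Cartan), uniformizer `ϖ` (★ `IsUniformizingElement`), `ψ : AddChar F M` into any commutative
monoid with `hψ' : ∃ y, v y ≤ |ϖ|⁻¹ ∧ ψ y ≠ 1` (non-triviality on `𝔭⁻¹`; triviality on `𝒪` is not even needed here).  HONEST LABEL: HC_CM is proved only modulo the 7 printed
citations (2 remaining named inputs: hLiu418 = stmt-HodgeConjecture-24832, h413 = stmt-HodgeConjecture-24833) until rung 0 closes; count-neutral generic algebra.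

THE MATHEMATICS [HarishChandra1999, §20 (1) p. 84 and Lemma 19.3; CartierCorvallis1979, §IV.2 (Cartan decomposition); Howe1977Kirillov, §1].
Write `x = k₁⁻¹ ϖ^a k₂⁻¹` with `k₁, k₂ ∈ GL_n(𝒪)` and `a ∈ ℤⁿ` MONOTONE (★ Cartan, exponents re-sorted by the permutation `Fin.rev`, §1).  For `y ∈ 𝒪`, a position `(i, j)` and
`m ≥ max(N', ν' + a_i − a_j)`, the TEST ELEMENT `k := k₁⁻¹ (1 + ϖ^m y E_{ij}) k₁` lies in `K_{N'}` (normality, ★ `conj_mem_congruenceGL`) AND `x⁻¹kx = k₂ (ϖ^{−a}(1 + ϖ^m y E_{ij})ϖ^a) k₂⁻¹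
= k₂ (1 + ϖ^{m + a_j − a_i} y E_{ij}) k₂⁻¹ ∈ K_{ν'}` (★ `coe_zpowDiagGL_inv_mul_mul_sub_one_apply`) (§2); and `tr(X(k − 1)) = ϖ^m y·(k₁Xk₁⁻¹)_{ji}` (★ `map_trace_mul_coe_conj_sub_one`,
`trace_mul_smul_single`).  So OCC gives `ψ(ϖ^{m_{ij}} (k₁Xk₁⁻¹)_{ji} y) = 1` for all `y ∈ 𝒪`, whence **`v((k₁Xk₁⁻¹)_{ji}) ≤ |ϖ|^{−m_{ij}}`, `m_{ij} = max(N', ν' + a_i − a_j)`** (★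
`valuation_le_one_of_forall_map_mul_eq_one`) (§3).  Split `k₁Xk₁⁻¹ = T + B`: `B` = the entries at positions with `a_i − a_j ≤ N' − ν'` (`v ≤ |ϖ|^{−N'}`), `T` = the rest — supported where
`a_i − a_j > N' − ν' ≥ 0`, i.e. (monotone `a`) `j < i`... in matrix coordinates `(j, i)` with row `<` column: `T` is STRICTLY UPPER TRIANGULAR, hence NILPOTENT (★
`isNilpotent_of_blockTriangular_of_diag_eq_zero`), and **`X = k₁⁻¹Tk₁ + k₁⁻¹Bk₁ ∈ 𝒩 + 𝔤(q^{N'})`** (§4 `exists_nilpotent_add_valBound_of_occurrence`).  Needs `1 ≤ ν' ≤ N'`.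

## References
* [HarishChandra1999] Harish-Chandra (DeBacker–Sally), *Admissible Invariant Distributions on Reductive p-adic Groups*, ULECT 16 (1999), §20 (1) p. 84, Lemma 19.3.
* [CartierCorvallis1979] P. Cartier, *Representations of p-adic groups: a survey*, Proc. Sympos. Pure Math. 33 (Corvallis 1979), Part 1, §IV.2 (Cartan decomposition).
* [Howe1977Kirillov] R. Howe, *Kirillov theory for compact p-adic groups*, Pacific J. Math. 73 (1977), 365–381, §1.
-/

set_option autoImplicit false
-- the mandated namespace repeats `HodgeConjecture.HodgeConjecture`, as in every `Theorems/*.lean` of this sub-problem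
set_option linter.dupNamespace false

noncomputable section

open scoped MatrixGroups
open Matrix ValuativeRel Literature.NumberTheory.Automorphic

namespace Summit.HodgeConjecture.HodgeConjecture.Cruxes.H413.K2E3CongruenceLayerOccurrenceNilpotentGL

variable {F : Type*} [Field F] [ValuativeRel F] {n : ℕ} {ϖ : F}

/-! ## §1 Cartan decomposition with MONOTONE exponents -/

/-- **CARTAN WITH INCREASING EXPONENTS**: every `x ∈ GL_n(F)` is `k₁⁻¹ ϖ^a k₂⁻¹`, i.e. `k₁ x k₂ = ϖ^a`, with `k₁, k₂ ∈ GL_n(𝒪)` and `a : Fin n → ℤ` MONOTONE (★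
`exists_glInt_mul_mul_eq_zpowDiagGL` gives antitone exponents; re-sort with the permutation matrix of `Fin.rev`, ★ `exists_glInt_mul_zpowDiagGL_mul_eq_of_perm`).
[cite: CartierCorvallis1979, §IV.2] -/
theorem exists_glInt_mul_mul_eq_zpowDiagGL_monotone [IsDiscreteValuationRing 𝒪[F]] (hϖ : IsUniformizingElement ϖ) (x : GL (Fin n) F) :
    ∃ k₁ ∈ glInt n F, ∃ k₂ ∈ glInt n F, ∃ a : Fin n → ℤ, Monotone a ∧ k₁ * x * k₂ = zpowDiagGL hϖ.ne_zero a := by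
  obtain ⟨k₁, hk₁, k₂, hk₂, a, ha, h⟩ := exists_glInt_mul_mul_eq_zpowDiagGL hϖ x
  obtain ⟨l₁, hl₁, l₂, hl₂, hl⟩ := CartanUnique.exists_glInt_mul_zpowDiagGL_mul_eq_of_perm hϖ.ne_zero (a := a) (b := a ∘ Fin.rev) Fin.revPerm
    (fun i => by rw [Function.comp_apply, Fin.revPerm_apply, Fin.rev_rev])
  refine ⟨l₁ * k₁, Subgroup.mul_mem _ hl₁ hk₁, k₂ * l₂, Subgroup.mul_mem _ hk₂ hl₂, a ∘ Fin.rev, fun i j hij => ha (Fin.rev_le_rev.2 hij), ?_⟩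
  rw [← hl, ← h]; group

/-! ## §2 The test elements `k₁⁻¹ (1 + ϖ^m y E_{ij}) k₁` -/

omit [ValuativeRel F] in
/-- Exponent bookkeeping: `ϖ^{c} · ϖ^m = ϖ^{ν'} · ϖ^t` in `F` when `c + m = ν' + t` (`c ∈ ℤ`; `m, ν', t ∈ ℕ`; `ϖ ≠ 0`). [folklore] -/
theorem zpow_mul_pow_eq_pow_mul_pow (hϖ0 : ϖ ≠ 0) {c : ℤ} {m ν' t : ℕ} (h : c + m = ν' + t) :
    ϖ ^ c * ϖ ^ m = ϖ ^ ν' * ϖ ^ t := by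
  rw [← zpow_natCast, ← zpow_natCast, ← zpow_natCast, ← zpow_add₀ hϖ0, ← zpow_add₀ hϖ0, h]

/-- **`ϖ^{−a}(1 + ϖ^m y E_{ij})ϖ^a ∈ K_{ν'}`** when `a_j − a_i + m ≥ ν' ≥ 1` and `y ∈ 𝒪`: its matrix is `1 + ϖ^{ν'}·(ϖ^t y) E_{ij}` with `t = a_j − a_i + m − ν' ≥ 0`
(★ `coe_zpowDiagGL_inv_mul_mul_sub_one_apply`, ★ `mem_congruenceGL_of_coe_eq_one_add_smul`). [cite: HarishChandra1999, §20 (1) p. 84] -/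
theorem zpowDiagGL_inv_conj_single_mem_congruenceGL (hϖ : IsUniformizingElement ϖ) (a : Fin n → ℤ) {m ν' : ℕ} (hν' : 1 ≤ ν') (hm : 1 ≤ m) (i j : Fin n)
    (hle : (ν' : ℤ) ≤ a j - a i + m) {y : F} (hy : y ∈ 𝒪[F]) :
    (zpowDiagGL hϖ.ne_zero a)⁻¹ * Matrix.GeneralLinearGroup.mk'' (1 + ϖ ^ m • Matrix.single i j y)
        (isUnit_det_one_add_smul hϖ hm (K2E3CongruenceLayerCharactersGL.isIntegralMatrix_single i j hy)) * zpowDiagGL hϖ.ne_zero a ∈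
      congruenceGL n (valuation F ϖ ^ ν') := by
  obtain ⟨t, ht⟩ : ∃ t : ℕ, a j - a i + (m : ℤ) = ν' + t := ⟨(a j - a i + m - ν').toNat, by rw [Int.toNat_of_nonneg (by omega)]; omega⟩
  have hty : ϖ ^ t * y ∈ 𝒪[F] := mul_mem (hϖ.pow_mem t) hy
  refine mem_congruenceGL_of_coe_eq_one_add_smul hϖ hν' (K2E3CongruenceLayerCharactersGL.isIntegralMatrix_single i j hty) ?_
  rw [← sub_eq_iff_eq_add']
  ext r c
  rw [coe_zpowDiagGL_inv_mul_mul_sub_one_apply, Matrix.smul_apply, smul_eq_mul]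
  change ϖ ^ (a c - a r) * ((1 + ϖ ^ m • Matrix.single i j y) - 1) r c = _
  rw [add_sub_cancel_left, Matrix.smul_apply, smul_eq_mul, Matrix.single_apply, Matrix.single_apply]
  split_ifs with h
  · obtain ⟨rfl, rfl⟩ := h
    rw [← mul_assoc, zpow_mul_pow_eq_pow_mul_pow hϖ.ne_zero ht, mul_assoc]
  · rw [mul_zero, mul_zero, mul_zero]

/-- **THE TEST ELEMENT AND ITS OVERLAP MEMBERSHIP.**  `x = k₁⁻¹ ϖ^a k₂⁻¹` (`k₁ x k₂ = ϖ^a`, `kᵢ ∈ GL_n(𝒪)`), `u = 1 + ϖ^m y E_{ij}` (`y ∈ 𝒪`, `m ≥ max(N', ν' + a_i − a_j)`, `1 ≤ ν'`, `1 ≤ N'`),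
`k := k₁⁻¹ u k₁`: then `k ∈ K_{N'}` and `x⁻¹ k x ∈ K_{ν'}` (`x⁻¹kx = k₂(ϖ^{−a}uϖ^a)k₂⁻¹`; normality ★ `conj_mem_congruenceGL`). [cite: HarishChandra1999, §20 (1) p. 84] [cite: CartierCorvallis1979, §IV.2] -/
theorem test_mem_and_conj_mem (hϖ : IsUniformizingElement ϖ) {a : Fin n → ℤ} {k₁ k₂ x : GL (Fin n) F} (hk₁ : k₁ ∈ glInt n F) (hk₂ : k₂ ∈ glInt n F)
    (hx : k₁ * x * k₂ = zpowDiagGL hϖ.ne_zero a) {N' ν' m : ℕ} (hN' : 1 ≤ N') (hν' : 1 ≤ ν') (hmN : N' ≤ m) (i j : Fin n) (hma : (ν' : ℤ) + a i - a j ≤ m)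
    {y : F} (hy : y ∈ 𝒪[F]) :
    k₁⁻¹ * Matrix.GeneralLinearGroup.mk'' (1 + ϖ ^ m • Matrix.single i j y)
        (isUnit_det_one_add_smul hϖ (hN'.trans hmN) (K2E3CongruenceLayerCharactersGL.isIntegralMatrix_single i j hy)) * k₁⁻¹⁻¹ ∈ congruenceGL n (valuation F ϖ ^ N') ∧
      x⁻¹ * (k₁⁻¹ * Matrix.GeneralLinearGroup.mk'' (1 + ϖ ^ m • Matrix.single i j y)
        (isUnit_det_one_add_smul hϖ (hN'.trans hmN) (K2E3CongruenceLayerCharactersGL.isIntegralMatrix_single i j hy)) * k₁⁻¹⁻¹) * x ∈ congruenceGL n (valuation F ϖ ^ ν') := by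
  set u := Matrix.GeneralLinearGroup.mk'' (1 + ϖ ^ m • Matrix.single i j y)
    (isUnit_det_one_add_smul hϖ (hN'.trans hmN) (K2E3CongruenceLayerCharactersGL.isIntegralMatrix_single i j hy)) with hu_def
  have hum : u ∈ congruenceGL n (valuation F ϖ ^ m) := mk''_one_add_smul_mem_congruenceGL hϖ (hN'.trans hmN) (K2E3CongruenceLayerCharactersGL.isIntegralMatrix_single i j hy)
  have huN : u ∈ congruenceGL n (valuation F ϖ ^ N') := congruenceGL_mono (pow_le_pow_right_of_le_one' hϖ.valuation_le_one hmN) hum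
  refine ⟨conj_mem_congruenceGL (Subgroup.inv_mem _ hk₁) huN, ?_⟩
  -- `x = k₁⁻¹ ϖ^a k₂⁻¹`, so `x⁻¹ (k₁⁻¹ u k₁) x = k₂ (ϖ^{-a} u ϖ^a) k₂⁻¹`
  have hx' : x = k₁⁻¹ * zpowDiagGL hϖ.ne_zero a * k₂⁻¹ := by rw [← hx]; group
  have e : x⁻¹ * (k₁⁻¹ * u * k₁⁻¹⁻¹) * x = k₂ * ((zpowDiagGL hϖ.ne_zero a)⁻¹ * u * zpowDiagGL hϖ.ne_zero a) * k₂⁻¹ := by rw [hx']; group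
  rw [e]
  exact conj_mem_congruenceGL hk₂ (zpowDiagGL_inv_conj_single_mem_congruenceGL hϖ a hν' (hN'.trans hmN) i j (by omega) hy)

/-! ## §3 OCC ⇒ per-entry valuation bounds on `k₁ X k₁⁻¹` -/

section Occurrence

variable {M : Type*} [CommMonoid M] (ψ : AddChar F M)

/-- **THE ENTRY BOUND.**  If `χ_X` is trivial on `K_{N'} ∩ xK_{ν'}x⁻¹` (OCC) with `x = k₁⁻¹ϖ^a k₂⁻¹` as above, then for every position `(i, j)` and every `m ≥ max(N', ν' + a_i − a_j)`:
`v(ϖ^m · (k₁Xk₁⁻¹)_{ji}) ≤ 1` — test on `k₁⁻¹(1 + ϖ^m y E_{ij})k₁`, `y ∈ 𝒪` (`tr(X(k−1)) = tr(k₁Xk₁⁻¹ · ϖ^m y E_{ij}) = ϖ^m (k₁Xk₁⁻¹)_{ji} y`, ★ `map_trace_mul_coe_conj_sub_one`,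
★ `trace_mul_smul_single`) and ★ `valuation_le_one_of_forall_map_mul_eq_one` (`ψ` non-trivial on `𝔭⁻¹`). [cite: HarishChandra1999, §20 (1) p. 84] [cite: Howe1977Kirillov, §1] -/
theorem valuation_pow_mul_conj_apply_le_one (hϖ : IsUniformizingElement ϖ) (hψ' : ∃ z : F, valuation F z ≤ (valuation F ϖ)⁻¹ ∧ ψ z ≠ 1)
    {a : Fin n → ℤ} {k₁ k₂ x : GL (Fin n) F} (hk₁ : k₁ ∈ glInt n F) (hk₂ : k₂ ∈ glInt n F) (hx : k₁ * x * k₂ = zpowDiagGL hϖ.ne_zero a)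
    {N' ν' : ℕ} (hN' : 1 ≤ N') (hν' : 1 ≤ ν') {X : Matrix (Fin n) (Fin n) F}
    (hocc : ∀ k ∈ congruenceGL n (valuation F ϖ ^ N'), x⁻¹ * k * x ∈ congruenceGL n (valuation F ϖ ^ ν') →
      ψ (Matrix.trace (X * ((k : Matrix (Fin n) (Fin n) F) - 1))) = 1)
    (i j : Fin n) {m : ℕ} (hmN : N' ≤ m) (hma : (ν' : ℤ) + a i - a j ≤ m) :
    valuation F (ϖ ^ m * ((k₁ : Matrix (Fin n) (Fin n) F) * X * ((k₁⁻¹ : GL (Fin n) F) : Matrix (Fin n) (Fin n) F)) j i) ≤ 1 := by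
  refine K2E3CongruenceLayerCharactersGL.valuation_le_one_of_forall_map_mul_eq_one ψ hϖ hψ' fun y hy => ?_
  have hy' : y ∈ 𝒪[F] := (Valuation.mem_integer_iff _ _).2 hy
  obtain ⟨hk, hconj⟩ := test_mem_and_conj_mem hϖ hk₁ hk₂ hx hN' hν' hmN i j hma hy'
  have h := hocc _ hk hconj
  rwa [K2E3CongruenceLayerCharactersGL.map_trace_mul_coe_conj_sub_one, inv_inv,
    show ((Matrix.GeneralLinearGroup.mk'' (1 + ϖ ^ m • Matrix.single i j y)
        (isUnit_det_one_add_smul hϖ (hN'.trans hmN) (K2E3CongruenceLayerCharactersGL.isIntegralMatrix_single i j hy')) : GL (Fin n) F) : Matrix (Fin n) (Fin n) F) =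
        1 + ϖ ^ m • Matrix.single i j y from rfl,
    add_sub_cancel_left, K2E3CongruenceLayerCharactersGL.trace_mul_smul_single] at h

/-- The entry bound as a valuation inequality on the entry itself: `v((k₁Xk₁⁻¹)_{ji}) ≤ |ϖ|^{−m}`. [cite: HarishChandra1999, §20 (1) p. 84] -/
theorem valuation_conj_apply_le (hϖ : IsUniformizingElement ϖ) (hψ' : ∃ z : F, valuation F z ≤ (valuation F ϖ)⁻¹ ∧ ψ z ≠ 1)
    {a : Fin n → ℤ} {k₁ k₂ x : GL (Fin n) F} (hk₁ : k₁ ∈ glInt n F) (hk₂ : k₂ ∈ glInt n F) (hx : k₁ * x * k₂ = zpowDiagGL hϖ.ne_zero a)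
    {N' ν' : ℕ} (hN' : 1 ≤ N') (hν' : 1 ≤ ν') {X : Matrix (Fin n) (Fin n) F}
    (hocc : ∀ k ∈ congruenceGL n (valuation F ϖ ^ N'), x⁻¹ * k * x ∈ congruenceGL n (valuation F ϖ ^ ν') →
      ψ (Matrix.trace (X * ((k : Matrix (Fin n) (Fin n) F) - 1))) = 1)
    (i j : Fin n) {m : ℕ} (hmN : N' ≤ m) (hma : (ν' : ℤ) + a i - a j ≤ m) :
    valuation F (((k₁ : Matrix (Fin n) (Fin n) F) * X * ((k₁⁻¹ : GL (Fin n) F) : Matrix (Fin n) (Fin n) F)) j i) ≤ (valuation F ϖ ^ m)⁻¹ := by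
  have hv : 0 < valuation F ϖ ^ m := pow_pos ((Valuation.pos_iff _).mpr hϖ.ne_zero) _
  have h := valuation_pow_mul_conj_apply_le_one ψ hϖ hψ' hk₁ hk₂ hx hN' hν' hocc i j hmN hma
  rw [map_mul, map_pow] at h
  rwa [← mul_le_mul_iff_right₀ hv, mul_inv_cancel₀ hv.ne']

/-! ## §4 The decomposition `X = nilpotent + bounded` -/

/-- **OCC ⇒ `k₁Xk₁⁻¹ = T + B` WITH `T` STRICTLY UPPER TRIANGULAR AND `v(B) ≤ |ϖ|^{−N'}`** (`1 ≤ ν' ≤ N'`, `a` MONOTONE Cartan exponents of `x`, `k₁ x k₂ = ϖ^a`): `B` keeps the entries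
`(j,i)` with `a_i − a_j ≤ N' − ν'` (there `m_{ij} = N'`), `T` the entries with `a_i − a_j > N' − ν' ≥ 0` — so `a_j < a_i`, hence `j < i` (monotone `a`): row `<` column.
[cite: HarishChandra1999, §20 (1) p. 84 and Lemma 19.3] [cite: CartierCorvallis1979, §IV.2] -/
theorem exists_upperTriangular_add_valBound_of_occurrence (hϖ : IsUniformizingElement ϖ) (hψ' : ∃ z : F, valuation F z ≤ (valuation F ϖ)⁻¹ ∧ ψ z ≠ 1)
    {a : Fin n → ℤ} (ha : Monotone a) {k₁ k₂ x : GL (Fin n) F} (hk₁ : k₁ ∈ glInt n F) (hk₂ : k₂ ∈ glInt n F) (hx : k₁ * x * k₂ = zpowDiagGL hϖ.ne_zero a)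
    {N' ν' : ℕ} (hν' : 1 ≤ ν') (hνN : ν' ≤ N') {X : Matrix (Fin n) (Fin n) F}
    (hocc : ∀ k ∈ congruenceGL n (valuation F ϖ ^ N'), x⁻¹ * k * x ∈ congruenceGL n (valuation F ϖ ^ ν') →
      ψ (Matrix.trace (X * ((k : Matrix (Fin n) (Fin n) F) - 1))) = 1) :
    ∃ T B : Matrix (Fin n) (Fin n) F, T.BlockTriangular id ∧ (∀ r, T r r = 0) ∧ ValBound (valuation F ϖ ^ N')⁻¹ B ∧
      (k₁ : Matrix (Fin n) (Fin n) F) * X * ((k₁⁻¹ : GL (Fin n) F) : Matrix (Fin n) (Fin n) F) = T + B := by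
  classical
  have hN' : 1 ≤ N' := hν'.trans hνN
  set X' := (k₁ : Matrix (Fin n) (Fin n) F) * X * ((k₁⁻¹ : GL (Fin n) F) : Matrix (Fin n) (Fin n) F) with hX'_def
  -- `T` = entries `(r, c)` with `a c - a r > N' - ν'`, `B` = the rest
  refine ⟨Matrix.of fun r c => if (N' : ℤ) - ν' < a c - a r then X' r c else 0, Matrix.of fun r c => if (N' : ℤ) - ν' < a c - a r then 0 else X' r c,
    fun r c hcr => ?_, fun r => ?_, fun r c => ?_, ?_⟩
  · -- upper triangular: `c < r ⇒ a c ≤ a r ⇒` the condition fails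
    rw [Matrix.of_apply, if_neg]
    have : a c ≤ a r := ha (le_of_lt hcr)
    omega
  · rw [Matrix.of_apply, if_neg (by omega)]
  · rw [Matrix.of_apply]
    split_ifs with h
    · rw [map_zero]; exact zero_le
    · -- here `m_{cr} = N'` works: `ν' + a c - a r ≤ N'`
      exact valuation_conj_apply_le ψ hϖ hψ' hk₁ hk₂ hx hN' hν' hocc c r le_rfl (by omega)
  · ext r c
    rw [Matrix.add_apply, Matrix.of_apply, Matrix.of_apply]
    split_ifs <;> simp

/-- **OCC ⇒ `X ∈ 𝒩 + 𝔤(q^{N'})`**: if the layer character `χ_X` of `K_{N'}` is trivial on `K_{N'} ∩ xK_{ν'}x⁻¹` for SOME `x ∈ GL_n(F)` (`1 ≤ ν' ≤ N'`), then `X = Z + B` with `Z` NILPOTENT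
(a `GL_n(𝒪)`-conjugate of a strictly upper triangular matrix, ★ `isNilpotent_of_blockTriangular_of_diag_eq_zero`) and `v(B) ≤ |ϖ|^{−N'}` — the elementary form of HC1999 §20 (1)
«`𝒪_0^G ⊂ 𝒩 + L_{ν₀}^*`» for the abelian layers (memo (C3)).  [cite: HarishChandra1999, §20 (1) p. 84 and Lemma 19.3] [cite: CartierCorvallis1979, §IV.2] [cite: Howe1977Kirillov, §1] -/
theorem exists_nilpotent_add_valBound_of_occurrence [IsDiscreteValuationRing 𝒪[F]] (hϖ : IsUniformizingElement ϖ)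
    (hψ' : ∃ z : F, valuation F z ≤ (valuation F ϖ)⁻¹ ∧ ψ z ≠ 1) {N' ν' : ℕ} (hν' : 1 ≤ ν') (hνN : ν' ≤ N') {X : Matrix (Fin n) (Fin n) F} (x : GL (Fin n) F)
    (hocc : ∀ k ∈ congruenceGL n (valuation F ϖ ^ N'), x⁻¹ * k * x ∈ congruenceGL n (valuation F ϖ ^ ν') →
      ψ (Matrix.trace (X * ((k : Matrix (Fin n) (Fin n) F) - 1))) = 1) :
    ∃ Z B : Matrix (Fin n) (Fin n) F, IsNilpotent Z ∧ ValBound (valuation F ϖ ^ N')⁻¹ B ∧ X = Z + B := by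
  obtain ⟨k₁, hk₁, k₂, hk₂, a, ha, hx⟩ := exists_glInt_mul_mul_eq_zpowDiagGL_monotone hϖ x
  obtain ⟨T, B, hT, hTd, hB, hX'⟩ := exists_upperTriangular_add_valBound_of_occurrence ψ hϖ hψ' ha hk₁ hk₂ hx hν' hνN hocc
  obtain ⟨N, hN⟩ := Literature.LinearAlgebra.Matrix.isNilpotent_of_blockTriangular_of_diag_eq_zero hT hTd
  have hkk : ((k₁⁻¹ : GL (Fin n) F) : Matrix (Fin n) (Fin n) F) * (k₁ : Matrix (Fin n) (Fin n) F) = 1 := by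
    rw [← Units.val_mul, inv_mul_cancel, Units.val_one]
  have hkk' : (k₁ : Matrix (Fin n) (Fin n) F) * ((k₁⁻¹ : GL (Fin n) F) : Matrix (Fin n) (Fin n) F) = 1 := by
    rw [← Units.val_mul, mul_inv_cancel, Units.val_one]
  -- `X = k₁⁻¹ (T + B) k₁`
  have hX : X = ((k₁⁻¹ : GL (Fin n) F) : Matrix (Fin n) (Fin n) F) * T * (k₁ : Matrix (Fin n) (Fin n) F) +
      ((k₁⁻¹ : GL (Fin n) F) : Matrix (Fin n) (Fin n) F) * B * (k₁ : Matrix (Fin n) (Fin n) F) := by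
    rw [← Matrix.add_mul, ← Matrix.mul_add, ← hX']
    simp only [← Matrix.mul_assoc, hkk, Matrix.one_mul]
    rw [Matrix.mul_assoc, hkk, Matrix.mul_one]
  refine ⟨_, _, ⟨N, ?_⟩, ?_, hX⟩
  · -- `(k₁⁻¹ T k₁)^N = k₁⁻¹ T^N k₁ = 0`
    have hconj : ∀ M : ℕ, (((k₁⁻¹ : GL (Fin n) F) : Matrix (Fin n) (Fin n) F) * T * (k₁ : Matrix (Fin n) (Fin n) F)) ^ M =
        ((k₁⁻¹ : GL (Fin n) F) : Matrix (Fin n) (Fin n) F) * T ^ M * (k₁ : Matrix (Fin n) (Fin n) F) := by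
      intro M
      induction M with
      | zero => rw [pow_zero, pow_zero, Matrix.mul_one, hkk]
      | succ M ih =>
        rw [pow_succ, ih, pow_succ]
        simp only [Matrix.mul_assoc]
        rw [← Matrix.mul_assoc (k₁ : Matrix (Fin n) (Fin n) F) ((k₁⁻¹ : GL (Fin n) F) : Matrix (Fin n) (Fin n) F), hkk', Matrix.one_mul]
    rw [hconj, hN, Matrix.mul_zero, Matrix.zero_mul]
  · have h := ((valBound_one_of_mem_glInt (Subgroup.inv_mem _ hk₁)).mul hB).mul (valBound_one_of_mem_glInt hk₁)
    rwa [one_mul, mul_one] at h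

end Occurrence

end Summit.HodgeConjecture.HodgeConjecture.Cruxes.H413.K2E3CongruenceLayerOccurrenceNilpotentGL

end
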